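import Summits.BirchSwinnertonDyer.Rank1Residual.Additive.SplitMultiplicativeBaseChange
import Literature.RingTheory.DiscreteValuationRing.AdicCompletionResidueField
import Mathlib.FieldTheory.Finite.GaloisField
import Mathlib.Algebra.Polynomial.SpecificDegree
import HarnessLib

/-!
# Multiplicative places under base change `ℚ → K`: split / non-split by the PARITY of the
# residue degree (row T-MIL-ODD, FILE A-1a; seat n1011-p01 GEN 5)

HONEST FRAMING (cell `b2b-bsdres`, run/shared/lean/b2b/bsd-rank1-residual/, verbatim in every
file): the goal of the cell is to DELETE the COMBINATION-SHAPED residual classes of the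
Birch–Swinnerton-Dyer formula for ALL analytic-rank `≤ 1` elliptic curves over `ℚ` — "full BSD
formula for every rank `≤ 1` curve in class `C`" assembled STRICTLY from published theorems — so
that the rank-`≤ 1` remainder becomes exactly the CONSTRUCTION-SHAPED classes, which are TYPED
(missing-input `Prop`s), NOT attempted. This is not "finishing BSD". Sub-classes X3♯(M) / X4(M)
(additive, potentially multiplicative prime; base-change-and-descend): a RESEARCH ROUTE; they stay
CONSTRUCTION-SHAPED; nothing is booked by this file; no mark / label moved. THEOREMS ONLY: no
definition, no named fact, no `sorry`.

## What and why (row T-MIL-ODD, `cells/n1011/skel/T-MIL-ODD.md`)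

The base-change-and-descend theorems of `AdditivePotMult/Descent.lean` carry Milne's quadratic
BSD-quotient identity as the hypothesis `hWR` (named facts A65/A73,
`Milne1972.bsdQuotient_baseChange_quadratic[_anyModel]`), and the tree reduces the rank-0
imaginary form of that identity to its `2`-adic part plus, for every ODD prime `p`, the identity
`v_p(|N_{K/ℚ}(u')| · ∏_w c_w(W')) = v_p(|u_d| · ∏_ℓ c_ℓ(W) · ∏_ℓ c_ℓ(W^{(d)}))`
(`bsdRHS_baseChange_quadratic_of_padicValRat`, hypothesis `hodd`). That identity is local
bookkeeping, prime by prime; this file supplies the MULTIPLICATIVE places: for `V/ℚ` globally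
minimal with multiplicative reduction at `ℓ`, `K` ANY number field and `𝔭 ∣ ℓ` a place of `K`
with `N(𝔭) = ℓ^f`,

* `hasSplitMultiplicativeReductionAt_baseChange_iff_splits_map_of_mult` — `V ⊗ K` is split
  multiplicative at `𝔭` iff the node-tangent quadratic of `V_ℤ mod ℓ` splits in the residue field
  `k_𝔭` (model independence + `V_ℤ ⊗ 𝒪_𝔭` minimal multiplicative: additive-p2 / p16 pattern);
* `hasSplitMultiplicativeReductionAt_baseChange_of_mult_of_even` — **`f` even ⇒ `V ⊗ K` SPLIT at
  `𝔭`** whatever `V` is at `ℓ` (a quadratic over `𝔽_ℓ` acquires a root in `𝔽_{ℓ^f}`, `2 ∣ f`: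
  Mathlib `FiniteField.nonempty_algHom_of_finrank_dvd` on the stem field);
* `hasSplitMultiplicativeReductionAt_baseChange_iff_of_mult_of_odd` — **`f` odd ⇒ (`V ⊗ K` split at
  `𝔭` ⟺ `V` split at `ℓ`)** (an irreducible quadratic stays irreducible in an odd-degree
  extension: `Polynomial.Irreducible.natDegree_dvd_finrank`).

The Tamagawa-number consequences (`c_𝔭 = e·n` / `c_𝔭 ∈ {1,2}`, odd-`p` valuations) are in the
sibling `QuadraticBaseChangeTamagawaMultiplicative.lean`.

In print: Kramer, Trans. AMS 264 (1981) §2, Props. 1–2 (the Tate curve / twisted Tate curve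
upon a quadratic extension `K_w/F_v`: the split / non-split dichotomy by the residue extension);
Silverman *AEC* VII.5.1 (b), Ex. 3.5 and *ATAEC* IV.9.4 Step 2 (`c = n` split, `c ∈ {1,2}`
non-split). HONEST LIMITS: TOOL theorems; this file closes no class and discharges no fact by
itself (A65/A73 need the good / additive places, the `δ`-identity at the ramified prime and the
assembly — later stages of the row); nothing about any curve is asserted.
-/

noncomputable section

open scoped Classical NumberField

open Polynomial WeierstrassCurve NumberField IsDedekindDomain Rat.HeightOneSpectrum
  Literature.NumberTheory.EllipticCurves Literature.NumberTheory.EllipticCurves.Rank1Residual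
  Literature.NumberTheory.GaloisRepresentations Field
  Summit.BirchSwinnertonDyer.Rank1Residual.Additive

namespace Summit.BirchSwinnertonDyer.Rank1Residual.AdditivePotMult

/-! ## §0 Quadratics over a finite field in an extension of even / odd degree -/

section FiniteField

variable {F E : Type*} [Field F] [Field E] [Algebra F E]

/-- A polynomial of degree `2` over a field which does not split has no root, hence is
irreducible. [folklore] -/
theorem irreducible_of_natDegree_eq_two_of_not_splits {Q : F[X]} (hQ : Q.natDegree = 2)
    (hs : ¬ Q.Splits) : Irreducible Q := by
  refine Polynomial.irreducible_of_degree_le_three_of_not_isRoot (by simp [hQ]) ?_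
  intro x hx
  exact hs (Splits.of_natDegree_eq_two hQ hx)

/-- **A quadratic over a finite field splits in every extension of EVEN degree**: either it
already splits, or its stem field `F[T]/(Q)` has degree `2` over `F` and therefore embeds into the
finite field `E` (finite fields have a unique extension of each degree: Mathlib
`FiniteField.nonempty_algHom_of_finrank_dvd`), providing a root. Lidl–Niederreiter, *Finite
Fields*, Thm. 2.14 / Cor. 2.15. [folklore] -/
theorem splits_map_of_natDegree_eq_two_of_even_finrank [Finite E] {Q : F[X]}
    (hQ : Q.natDegree = 2) (heven : Even (Module.finrank F E)) :
    (Q.map (algebraMap F E)).Splits := by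
  by_cases hs : Q.Splits
  · exact hs.map _
  have hirr : Irreducible Q := irreducible_of_natDegree_eq_two_of_not_splits hQ hs
  haveI := Fact.mk hirr
  have hQ0 : Q ≠ 0 := hirr.ne_zero
  have hdeg : Module.finrank F (AdjoinRoot Q) = 2 := by
    rw [(AdjoinRoot.powerBasis hQ0).finrank, AdjoinRoot.powerBasis_dim, hQ]
  obtain ⟨φ⟩ : Nonempty (AdjoinRoot Q →ₐ[F] E) :=
    FiniteField.nonempty_algHom_of_finrank_dvd (by rw [hdeg]; exact even_iff_two_dvd.mp heven)
  refine Splits.of_natDegree_eq_two (x := φ (AdjoinRoot.root Q)) (by rw [natDegree_map, hQ]) ?_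
  rw [eval_map_algebraMap, Polynomial.aeval_algHom_apply, AdjoinRoot.aeval_eq,
    AdjoinRoot.mk_self, map_zero]

/-- **A quadratic that splits in an extension of ODD degree already splits**: otherwise it is
irreducible of degree `2`, and the degree of an irreducible polynomial acquiring a root divides
the degree of the extension (`Polynomial.Irreducible.natDegree_dvd_finrank`). [folklore] -/
theorem splits_of_splits_map_of_natDegree_eq_two_of_odd_finrank {Q : F[X]} (hQ : Q.natDegree = 2)
    (hodd : Odd (Module.finrank F E)) (hs : (Q.map (algebraMap F E)).Splits) : Q.Splits := by
  by_contra h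
  have hirr : Irreducible Q := irreducible_of_natDegree_eq_two_of_not_splits hQ h
  have h2 : 2 ∣ Module.finrank F E := hQ ▸ hirr.natDegree_dvd_finrank hs
  exact (Nat.not_even_iff_odd.mpr hodd) (even_iff_two_dvd.mpr h2)

/-- In an extension of odd degree a quadratic splits iff it splits over the base. [folklore] -/
theorem splits_map_iff_of_natDegree_eq_two_of_odd_finrank {Q : F[X]} (hQ : Q.natDegree = 2)
    (hodd : Odd (Module.finrank F E)) : (Q.map (algebraMap F E)).Splits ↔ Q.Splits :=
  ⟨splits_of_splits_map_of_natDegree_eq_two_of_odd_finrank hQ hodd, fun h => h.map _⟩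

end FiniteField

/-! ## §1 The residue field at a place above `ℓ`: characteristic, `𝔽_ℓ`-algebra, degree -/

section ResidueField

variable {K : Type} [Field K] [NumberField K] (ℓ : ℕ) [hℓ : Fact ℓ.Prime]
  (𝔭 : HeightOneSpectrum (𝓞 K))

/-- The rational prime `ℓ ∈ 𝔭` dies in the residue field `k_𝔭` of the completed local ring
`𝒪_𝔭`, so `k_𝔭` has characteristic `ℓ`. [folklore] -/
theorem charP_residueField_of_mem (hℓ𝔭 : ((ℓ : ℕ) : 𝓞 K) ∈ 𝔭.asIdeal) :
    CharP (IsLocalRing.ResidueField (𝔭.adicCompletionIntegers K)) ℓ := by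
  have hℓR : ((ℓ : ℕ) : 𝔭.adicCompletionIntegers K) ∈
      IsLocalRing.maximalIdeal (𝔭.adicCompletionIntegers K) := by
    rw [LocalPoints.mem_maximalIdeal_iff 𝔭]
    simpa using LocalPoints.valuation_natCast_lt_one 𝔭 hℓ𝔭
  have hℓk : ((ℓ : ℕ) : IsLocalRing.ResidueField (𝔭.adicCompletionIntegers K)) = 0 := by
    rw [← map_natCast (IsLocalRing.residue _), IsLocalRing.residue_eq_zero_iff]
    exact hℓR
  exact (CharP.charP_iff_prime_eq_zero hℓ.out).mpr hℓk

/-- `#k_𝔭 = N(𝔭)`: the residue field of the completion is `𝓞_K / 𝔭` (tree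
`residueFieldEquiv`), whose cardinality is the absolute norm. [folklore] -/
theorem natCard_residueField_eq_absNorm :
    Nat.card (IsLocalRing.ResidueField (𝔭.adicCompletionIntegers K)) = Ideal.absNorm 𝔭.asIdeal := by
  rw [HeightOneSpectrum.natCard_residueField_adicCompletionIntegers, Ideal.absNorm_apply,
    Submodule.cardQuot_apply]

/-- **`[k_𝔭 : 𝔽_ℓ] = f`** when `N(𝔭) = ℓ^f`, for the `𝔽_ℓ`-algebra structure `ZMod.algebra` on a
residue field of characteristic `ℓ` (`#k_𝔭 = ℓ^{[k_𝔭 : 𝔽_ℓ]}`, Mathlib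
`Module.natCard_eq_pow_finrank`). [folklore] -/
theorem finrank_zmod_residueField_eq (hℓ𝔭 : ((ℓ : ℕ) : 𝓞 K) ∈ 𝔭.asIdeal) {f : ℕ}
    (hN : Ideal.absNorm 𝔭.asIdeal = ℓ ^ f) :
    letI := charP_residueField_of_mem ℓ 𝔭 hℓ𝔭
    letI := ZMod.algebra (IsLocalRing.ResidueField (𝔭.adicCompletionIntegers K)) ℓ
    Module.finrank (ZMod ℓ) (IsLocalRing.ResidueField (𝔭.adicCompletionIntegers K)) = f := by
  letI := charP_residueField_of_mem ℓ 𝔭 hℓ𝔭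
  letI := ZMod.algebra (IsLocalRing.ResidueField (𝔭.adicCompletionIntegers K)) ℓ
  have hcard := Module.natCard_eq_pow_finrank (K := ZMod ℓ)
    (V := IsLocalRing.ResidueField (𝔭.adicCompletionIntegers K))
  rw [natCard_residueField_eq_absNorm, hN, Nat.card_zmod] at hcard
  exact (Nat.pow_right_injective hℓ.out.two_le hcard).symm

end ResidueField

/-! ## §2 Split multiplicative reduction of `V ⊗ K` at `𝔭 ∣ ℓ`, read on `V_ℤ mod ℓ` in `k_𝔭` -/

section SplitCriterion

variable (V : WeierstrassCurve ℚ) [V.IsElliptic] [V.IsGloballyMinimal] (ℓ : ℕ) [hℓ : Fact ℓ.Prime]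
  {K : Type} [Field K] [NumberField K] (𝔭 : HeightOneSpectrum (𝓞 K))

/-- **`V ⊗ K` is split multiplicative at `𝔭 ∣ ℓ` iff the node-tangent quadratic of `V_ℤ mod ℓ`
splits in `k_𝔭`**, for `V/ℚ` globally minimal with multiplicative reduction at `ℓ`, `K` any number
field and ANY ring map `e : 𝔽_ℓ → k_𝔭` (there is exactly one). The chosen minimal model of
`V_K ⊗ K_𝔭` and the minimal equation `V_ℤ ⊗ 𝒪_𝔭` (additive-p2's
`isMinimalAt_and_hasMultiplicativeReductionAt_baseChange_of_mult`) have the same splitting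
behaviour (tree `hasSplitMultiplicativeReduction_iff_of_isMinimal_of_eq_smul`), and the node-tangent
quadratic of the latter is that of `V_ℤ` read through `ℤ → 𝔽_ℓ → k_𝔭`. The two one-sided special
cases in the tree are p16's `hasSplitMultiplicativeReductionAt_baseChange_of_hasSplitMultiplicativeReductionAtPrime`
and additive-p2's `not_hasSplitMultiplicativeReductionAt_baseChange_of_not_split` (`N(𝔭) = 3`).
[cite: SilvermanAEC2009, VII.5 Prop. 5.1(b) and VII.1 Prop. 1.3(b)] -/
theorem hasSplitMultiplicativeReductionAt_baseChange_iff_splits_map_of_mult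
    (hℓ𝔭 : ((ℓ : ℕ) : 𝓞 K) ∈ 𝔭.asIdeal) (hmult : V.HasMultiplicativeReductionAtPrime ℓ)
    (e : ZMod ℓ →+* IsLocalRing.ResidueField (𝔭.adicCompletionIntegers K)) :
    (V.baseChange K).HasSplitMultiplicativeReductionAt 𝔭 ↔
      (letI I := (integralModelInt V).map (Int.castRingHom (ZMod ℓ));
        ((C I.c₄ * X ^ 2 + C (I.a₁ * I.c₄) * X
          - C (54 * I.b₆ - 3 * I.b₂ * I.b₄ + I.a₂ * I.c₄)).map e).Splits) := by
  haveI : (V.baseChange K).IsElliptic := by rw [baseChange]; infer_instance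
  -- notation: `R = 𝒪_𝔭`, `Y = V_K ⊗ K_𝔭`
  obtain ⟨R, hR⟩ : ∃ R, R = 𝔭.adicCompletionIntegers K := ⟨_, rfl⟩
  subst hR
  obtain ⟨Y, hY⟩ : ∃ Y : WeierstrassCurve (𝔭.adicCompletion K),
      Y = (V.baseChange K).baseChange (𝔭.adicCompletion K) := ⟨_, rfl⟩
  obtain ⟨hminK, hmultK⟩ :=
    isMinimalAt_and_hasMultiplicativeReductionAt_baseChange_of_mult V hmult 𝔭 hℓ𝔭
  haveI hmin : Y.IsMinimal (𝔭.adicCompletionIntegers K) := by rw [hY]; exact hminK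
  have hΔY : Y.Δ ≠ 0 := by
    rw [hY, baseChange, map_Δ, baseChange, map_Δ]
    exact (_root_.map_ne_zero _).mpr ((_root_.map_ne_zero _).mpr V.isUnit_Δ.ne_zero)
  obtain ⟨D, hD⟩ : ∃ D : VariableChange (𝔭.adicCompletion K),
      (V.baseChange K).localMinimalModel 𝔭 = D • Y := by
    rw [hY]; exact ⟨_, rfl⟩
  have hmultY : Y.HasMultiplicativeReduction (𝔭.adicCompletionIntegers K) := by
    have h := hmultK
    unfold HasMultiplicativeReductionAt at h
    rw [hD, hasMultiplicativeReduction_iff_of_isMinimal_of_eq_smul _ rfl hΔY] at h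
    exact h
  -- the integral model of `Y` is `V_ℤ ⊗ 𝒪_𝔭`
  have h2 : Y.integralModel (𝔭.adicCompletionIntegers K) =
      (integralModelInt V).map (Int.castRingHom (𝔭.adicCompletionIntegers K)) := by
    refine integralModel_eq_of_baseChange_eq _ _ ?_
    rw [hY]
    conv_rhs => rw [← map_integralModelInt V]
    rw [baseChange, baseChange, baseChange, WeierstrassCurve.map_map, WeierstrassCurve.map_map,
      WeierstrassCurve.map_map]
    exact congrArg (integralModelInt V).map (RingHom.ext_int _ _)
  have hring : (algebraMap (𝔭.adicCompletionIntegers K)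
        (IsLocalRing.ResidueField (𝔭.adicCompletionIntegers K))).comp
          (Int.castRingHom (𝔭.adicCompletionIntegers K)) =
      e.comp (Int.castRingHom (ZMod ℓ)) :=
    RingHom.ext_int _ _
  haveI : (D • Y).IsMinimal (𝔭.adicCompletionIntegers K) := by
    rw [← hD]; exact instIsMinimalLocalMinimalModel 𝔭 (V.baseChange K)
  unfold HasSplitMultiplicativeReductionAt
  rw [hD, hasSplitMultiplicativeReduction_iff_of_isMinimal_of_eq_smul _ rfl hΔY,
    hasSplitMultiplicativeReduction_iff]
  constructor
  · rintro ⟨hM, hs⟩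
    rwa [h2, nodalTangents_map, Polynomial.map_map, hring, ← Polynomial.map_map,
      ← nodalTangents_map] at hs
  · intro hs
    refine ⟨hmultY, ?_⟩
    rw [h2, nodalTangents_map, Polynomial.map_map, hring, ← Polynomial.map_map, ← nodalTangents_map]
    exact hs

/-- The node-tangent quadratic of `V_ℤ mod ℓ` has degree `2` when `V` is multiplicative at `ℓ`
(its leading coefficient `c₄(V_ℤ)` is an `ℓ`-adic unit). [cite: SilvermanAEC2009, VII.5 Prop. 5.1(b)] -/
theorem natDegree_nodal_eq_two_of_mult (hmult : V.HasMultiplicativeReductionAtPrime ℓ) :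
    (letI I := (integralModelInt V).map (Int.castRingHom (ZMod ℓ));
      (C I.c₄ * X ^ 2 + C (I.a₁ * I.c₄) * X
        - C (54 * I.b₆ - 3 * I.b₂ * I.b₄ + I.a₂ * I.c₄)).natDegree) = 2 := by
  obtain ⟨-, hc⟩ := dvd_and_not_dvd_c₄_of_hasMultiplicativeReductionAtPrime V ℓ hmult
  have hc0 : ((integralModelInt V).map (Int.castRingHom (ZMod ℓ))).c₄ ≠ 0 := by
    rw [map_c₄, eq_intCast, ne_eq, ZMod.intCast_zmod_eq_zero_iff_dvd]
    exact hc
  simp only [sub_eq_add_neg, ← map_neg C]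
  exact natDegree_quadratic hc0

/-- Over `𝔽_ℓ` the node-tangent quadratic of `V_ℤ` splits iff `V` is SPLIT multiplicative at `ℓ`
(given multiplicative reduction; the two tree lemmas `splits_nodal_of_…` /
`not_splits_nodal_of_not_…` as one `iff`). [cite: SilvermanAEC2009, VII.5 Prop. 5.1(b)] -/
theorem splits_nodal_iff_hasSplitMultiplicativeReductionAtPrime
    (hmult : V.HasMultiplicativeReductionAtPrime ℓ) :
    (letI I := (integralModelInt V).map (Int.castRingHom (ZMod ℓ));
      (C I.c₄ * X ^ 2 + C (I.a₁ * I.c₄) * X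
        - C (54 * I.b₆ - 3 * I.b₂ * I.b₄ + I.a₂ * I.c₄)).Splits) ↔
      V.HasSplitMultiplicativeReductionAtPrime ℓ := by
  constructor
  · intro hs
    by_contra hns
    exact not_splits_nodal_of_not_hasSplitMultiplicativeReductionAtPrime V ℓ hmult hns hs
  · exact splits_nodal_of_hasSplitMultiplicativeReductionAtPrime V ℓ

/-- **Residue degree EVEN ⇒ `V ⊗ K` is SPLIT multiplicative at `𝔭`**, for `V/ℚ` globally minimal
with multiplicative reduction (split OR non-split) at `ℓ`, `K` any number field, `𝔭 ∣ ℓ` with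
`N(𝔭) = ℓ^f`, `f` even: the node-tangent quadratic over `𝔽_ℓ` has a root in `𝔽_{ℓ²} ⊆ k_𝔭`.
(The hypothesis `hN : N(𝔭) = ℓ^f` is the cell's `residueCard_eq_residueCard_pow_inertiaDeg`
(`FrobeniusPlaces`) with `f = f(𝔭|ℓ)` the inertia degree and `N(v_ℓ) = ℓ`; it is kept as an
equation so that this file needs no Frobenius imports.)
Kramer 1981 Prop. 2 / Silverman *AEC* Ex. 3.5: non-split multiplicative reduction becomes split
over the unramified quadratic extension of the residue field.
[cite: SilvermanAEC2009, VII.5 Prop. 5.1(b) and Exercise 3.5] -/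
theorem hasSplitMultiplicativeReductionAt_baseChange_of_mult_of_even
    (hℓ𝔭 : ((ℓ : ℕ) : 𝓞 K) ∈ 𝔭.asIdeal) (hmult : V.HasMultiplicativeReductionAtPrime ℓ)
    {f : ℕ} (hN : Ideal.absNorm 𝔭.asIdeal = ℓ ^ f) (hf : Even f) :
    (V.baseChange K).HasSplitMultiplicativeReductionAt 𝔭 := by
  letI := charP_residueField_of_mem ℓ 𝔭 hℓ𝔭
  letI := ZMod.algebra (IsLocalRing.ResidueField (𝔭.adicCompletionIntegers K)) ℓ
  rw [hasSplitMultiplicativeReductionAt_baseChange_iff_splits_map_of_mult V ℓ 𝔭 hℓ𝔭 hmult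
    (algebraMap (ZMod ℓ) _)]
  refine splits_map_of_natDegree_eq_two_of_even_finrank (natDegree_nodal_eq_two_of_mult V ℓ hmult) ?_
  rwa [finrank_zmod_residueField_eq ℓ 𝔭 hℓ𝔭 hN]

/-- **Residue degree ODD ⇒ `V ⊗ K` is split at `𝔭` iff `V` is split at `ℓ`**, for `V/ℚ`
globally minimal multiplicative at `ℓ`, `K` any number field, `𝔭 ∣ ℓ` with `N(𝔭) = ℓ^f`, `f`
odd (e.g. `f = 1`: a totally ramified or degree-one place): an irreducible quadratic over `𝔽_ℓ`
stays irreducible over `𝔽_{ℓ^f}`. Kramer 1981 Prop. 1.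
[cite: SilvermanAEC2009, VII.5 Prop. 5.1(b) and Exercise 3.5] -/
theorem hasSplitMultiplicativeReductionAt_baseChange_iff_of_mult_of_odd
    (hℓ𝔭 : ((ℓ : ℕ) : 𝓞 K) ∈ 𝔭.asIdeal) (hmult : V.HasMultiplicativeReductionAtPrime ℓ)
    {f : ℕ} (hN : Ideal.absNorm 𝔭.asIdeal = ℓ ^ f) (hf : Odd f) :
    (V.baseChange K).HasSplitMultiplicativeReductionAt 𝔭 ↔
      V.HasSplitMultiplicativeReductionAtPrime ℓ := by
  letI := charP_residueField_of_mem ℓ 𝔭 hℓ𝔭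
  letI := ZMod.algebra (IsLocalRing.ResidueField (𝔭.adicCompletionIntegers K)) ℓ
  rw [hasSplitMultiplicativeReductionAt_baseChange_iff_splits_map_of_mult V ℓ 𝔭 hℓ𝔭 hmult
    (algebraMap (ZMod ℓ) _),
    splits_map_iff_of_natDegree_eq_two_of_odd_finrank (natDegree_nodal_eq_two_of_mult V ℓ hmult)
      (by rwa [finrank_zmod_residueField_eq ℓ 𝔭 hℓ𝔭 hN]),
    splits_nodal_iff_hasSplitMultiplicativeReductionAtPrime V ℓ hmult]

end SplitCriterion

end Summit.BirchSwinnertonDyer.Rank1Residual.AdditivePotMult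

end
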